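/-
Copyright (c) 2026 the pub-hodgecm-mathlib formalisation cell (harness21).  Prover seat hodgecm-mathlib-K2E3-p34 (g2), Track B «K2-LIT», engine E3, unit U4 «Keys»; PART
«U4Keys» socket :182 (U4f-χ₁-ram-one-pos), programme A_pos (Roche's two-depth group `J_e`; both regimes cond_F χ₁ = k+1 ≤ m+1 = cond_E χ₁), brick (B3) «BRANCH A AT
POSITIVE DEPTH OVER THE TWO-DEPTH GROUP, ASSEMBLED in the (G3) frame» — the `J_e`-twin of ★ p863059 `K2E3BranchAIrreduciblePosDepth` (R90-C10-p02 (g2)), its §3 VERBATIM in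
structure with `J_{m+1} ↦ J_e`, through its GENERIC §2 `false_of_iwahoriDatum_of_cells` and with p02's typing cure (dealer K2E3-plan (g5) ROUND 4e (iii), U4-RAM TYPING
RULE #2).  KERNEL module: THEOREMS ONLY (no definition, no named fact, no `sorry`, no instance, no notation).
-/
import Summits.HodgeConjecture.HodgeConjecture.Theorems.K2E3BranchAIrreduciblePosDepth           -- ★ p863059 (R90-C10-p02 g2): GENERIC §2 `false_of_iwahoriDatum_of_cells` (★ Z2A-2 → ★ V2b → ★ p861573); brings ★ V1, the (G3) frame letters, ★ Z2A-3c
import Summits.HodgeConjecture.HodgeConjecture.Theorems.K2E3IwahoriTwoDepthLettersCM             -- ★ p862547 (K2E3-p14 g9): `exists_iwahoriDatum_K_zero_eq_levelGroup` (datum `K 0 = Je`, `K 1 = I`, `N̄ = eA⁻¹(N̄_w)`), model `le_inf_conj_of_forall_mem_iff` (`Jg ≤ I_w`)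
import Summits.HodgeConjecture.HodgeConjecture.Theorems.K2E3ConcaveLevelIwahoriCharacterCM      -- ★ p862709 (this seat): `theta_mul_concave` (the letter `hθmul` at `B := Je`)
import Summits.HodgeConjecture.HodgeConjecture.Theorems.K2E3BranchATorusWitnessLevelGroup        -- ★ p862782 (c2)^{<} (this seat): `exists_torusWitness_levelGroup` (the witness at `w₀`, `b₀ ∈ Je`)
import Summits.HodgeConjecture.HodgeConjecture.Theorems.K2E3BranchAIrreducibleTwoDepthCells     -- ★ p862990 (this seat): `exists_eq_borel_mul_weyl_mul_mem_of_sharp` (sharp big cell), `exists_shellWitness_of_mem_map_of_not_mem` (shell witnesses)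
import HarnessLib

/-!
# K2 ∕ E3 «EllipticInputs», unit U4 «Keys» — (U4f-χ₁-ram-one-pos), (B3): BRANCH A OF KEYS' THEOREM §7 (2) AT POSITIVE DEPTH OVER ROCHE'S TWO-DEPTH GROUP, ASSEMBLED
# «`χ₁` contracting, non-unitary, cond_E `= m+1 ≥ 2`, cond_F `= k+1 ≤ m+1`, an integral trace-one `t`, and `χ₁ ∘ N ≠ 1` on `𝒪ˣ` ⟹ `i(χ₁, 1)` is IRREDUCIBLE» on `U(Φ₃)(L⁺_v)`,
# `v` non-split, (G3)-explicit frame   [Keys1984 §3, §7 Thm (2); Roche1998 §3–§4; Casselman1995 §6.3–§6.4; MoyPrasad1996 §3; BruhatTits1972 (6.4.9)]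

Cell hodgecm-mathlib, Track B «K2-LIT», engine E3, crux item H413 = `stmt-HodgeConjecture-24833` (route `HCCMUnconditional`); line `K2_E3_EllipticInputs`, PART «U4Keys»
socket :182 `sig_K2E3KeysThmTwoContractingRamifiedCharOnePosDepth`, design D-I «vanishing functional» at POSITIVE depth over Roche's `J_χ` (memos `K2/K2E3-p37/g0/CENSUS-U4f-PosDepth…md`
§9, `K2/K2E3-p34/g2/CENSUS-Apos-lt-shells.md`, `K2/K2E3-p37/g2/MEMO-PosA-Recut…md`).  `--supports stmt-HodgeConjecture-24833 --as helper`; THEOREMS ONLY; (G3)-EXPLICIT frame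
(`L v w hw eA heA ϖ hϖ g₁ hg₁ K0 K1 I hK0 hK1 hI`) + the two-depth letters `(r₁ s₁ r₂ s₂) Jg hJg Je hJe` (★ D174 p862387 ∕ ★ p862547) + `w₀ hw₀` + a Haar measure on `N(L⁺_v)`.
NOT THE PAYER of :182 (Branch A only, modulo the trace-one letter; the frame-free wrapper is `K2E3BranchAIrreducibleTwoDepthLeaf`; Branch B at positive depth is O-182B).

THE POINT.  Design D-I at Roche's group `J_e = eA⁻¹(Jg)`, `e = (0 r₁ s₁; r₂ 0 r₁; s₂ r₂ 0)`, `r₁ + r₂ = m + 1 =` cond_E, `s₁ + s₂ = k + 1 =` cond_F, halves aligned: suppose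
`i(χ₁, 1)` reducible.  ★ V1 gives a `G`-stable `V ∋ f` with `f(1) ≠ 0` killed by `Λ_{w₀}` (witness RE-TYPED on arrival in the `smoothIndRep` currency — p02's cure); ★ p862547
the Iwahori datum `𝓘` with `𝓘.K 0 = J_e`, `𝓘.K 1 = I`, `𝓘.N̄ = eA⁻¹(N̄_w)`; then ★ p863059's GENERIC `false_of_iwahoriDatum_of_cells` (★ Z2A-2 → ★ V2b → ★ p861573) with
`θ(g) = χ₁(unit g₀₀)` — `hθmul` = ★ p862709 `theta_mul_concave` (letters `hcond`, `hcondF`, trace-one `t`, concavity read off the exponents by `omega`), `hθH` = ★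
`theta_eq_tau_of_mem` through `J_e ≤ I` (§1), `hθC` = ★ `theta_eq_one_of_map_mem` — and the cell family `R := {w₀} ∪ {r ∈ N̄ : r ∉ J_e, eA r off the SHARP big cell}`: the
covering `hcells` is the trichotomy «`w₀ n w₀ ∈ J_e`, or SHARP big cell `|x∕z| ≤ |ϖ|^{r₁}`, `|z| ≥ |ϖ|^{-s₁}` (`= h·w₀·b′`, ★ p862990 §1 over ★ p862537∕p862590), or the shell
representative `r = w₀ n w₀` itself»; the witnesses `hwit` are the TORUS witness at `w₀` (★ p862782, Branch A) and the SHELL witnesses ★ p862990 §2 (lower shells ★ p862772,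
upper shells ★ p862799 + ★ p862901; letters: the exact witnesses `u₁` (depth `m`) and `u₂` (`σ`-fixed, depth `k`)); `hθ` = ★ `theta_conj_eq_one`; `hΛ` = V1.  Hence `False`.
* §1 `levelGroup_le_iwahori` (`J_e ≤ I` along `eA`, from ★ p862547 model §1; needs `1 ≤ r₂`, `1 ≤ s₂`).
* §2 **`false_of_reducible_of_twoDepth`** (frame + exponents + conductor letters + `t` + `u` + `w₀` + Haar).
HONEST LABEL: HC_CM is proved only modulo the 7 printed citations (2 remaining named inputs: hLiu418 = stmt-HodgeConjecture-24832, h413 = stmt-HodgeConjecture-24833) until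
rung 0 closes; count-neutral — this file does NOT pay the leaf; :182 stays OPEN; no printed citation is discharged.

## References
* [Keys1984] D. Keys, *Principal series representations of special unitary groups over local fields*, Compositio Math. 51 (1984), §3, §7 Thm (2).
* [Roche1998] A. Roche, *Types and Hecke algebras for principal series representations of split reductive p-adic groups*, Ann. Sci. ÉNS (4) 31 (1998), §3–§4.
* [Casselman1995] W. Casselman, *Introduction to the theory of admissible representations of `p`-adic reductive groups* (1995), §6.3–§6.4.
* [MoyPrasad1996] A. Moy, G. Prasad, *Jacquet functors and unrefined minimal K-types*, Comment. Math. Helv. 71 (1996), §3.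
* [BruhatTits1972] F. Bruhat, J. Tits, *Groupes réductifs sur un corps local I*, Publ. Math. IHÉS 41 (1972), (4.4.4), (6.4.9).
-/

set_option autoImplicit false
-- the mandated namespace has the single-problem summit's repeated segment (`HodgeConjecture.HodgeConjecture`)
set_option linter.dupNamespace false

noncomputable section

open NumberField IsDedekindDomain MeasureTheory
open scoped Matrix MatrixGroups WithZero Valued
open Literature.NumberTheory Literature.NumberTheory.Automorphic Literature.NumberTheory.Automorphic.UnitaryGroup
open Literature.NumberTheory.Rogawski1990

namespace Summit.HodgeConjecture.HodgeConjecture.Cruxes.H413.K2E3BranchAIrreducibleTwoDepth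

open Summit.HodgeConjecture.HodgeConjecture.Cruxes.H413
open Summit.HodgeConjecture.HodgeConjecture.Cruxes.H413.K2E3DepthZeroIwahoriCharacterCM
open Summit.HodgeConjecture.HodgeConjecture.Cruxes.H413.K2E3BranchALettersCM
open Summit.HodgeConjecture.HodgeConjecture.Cruxes.H413.K2E3BranchATypeLettersCM
open Summit.HodgeConjecture.HodgeConjecture.Cruxes.H413.K2E3ConcaveLevelIwahoriCharacterCM

variable (L : Type) [Field L] [NumberField L] [IsCMField L] (v : HeightOneSpectrum (𝓞 ↥(maximalRealSubfield L)))
  (w : PlacesOver L v) (hw : IsCMField.complexConj L • w.1 = w.1)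
  (eA : Gqs L v ≃ₜ* ↥(unitaryGroupOfForm (galAdicCompletionMap (L := L) (IsCMField.complexConj L) hw) ((StdForm.antidiagonal 3).over (w.1.adicCompletion L))))
  (heA : ∀ g : Gqs L v,
    ((eA g : ↥(unitaryGroupOfForm (galAdicCompletionMap (L := L) (IsCMField.complexConj L) hw) ((StdForm.antidiagonal 3).over (w.1.adicCompletion L)))) :
        GL (Fin 3) (w.1.adicCompletion L)) =
      ((localNonsplitEquiv (IsCMField.complexConj L) (qsForm L) (IsCMField.complexConj_ne_one L) w hw g :
        ↥(unitaryGroupOfForm (galAdicCompletionMap (L := L) (IsCMField.complexConj L) hw) (placeForm (qsForm L) w.1))) : GL (Fin 3) (w.1.adicCompletion L)))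
  {ϖ : w.1.adicCompletion L} (hϖ : Valued.v ϖ = WithZero.exp (-1 : ℤ))
  (g₁ : GL (Fin 3) (w.1.adicCompletion L)) (hg₁ : (g₁ : Matrix (Fin 3) (Fin 3) (w.1.adicCompletion L)) = Matrix.diagonal ![(1 : w.1.adicCompletion L), 1, ϖ])
  (K0 K1 I : Subgroup (Gqs L v))
  (hK0 : K0 = ((glInt 3 (w.1.adicCompletion L)).subgroupOf
    (unitaryGroupOfForm (galAdicCompletionMap (L := L) (IsCMField.complexConj L) hw) ((StdForm.antidiagonal 3).over (w.1.adicCompletion L)))).comap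
      eA.toMulEquiv.toMonoidHom)
  (hK1 : K1 = (((glInt 3 (w.1.adicCompletion L)).map (MulAut.conj g₁).toMonoidHom).subgroupOf
    (unitaryGroupOfForm (galAdicCompletionMap (L := L) (IsCMField.complexConj L) hw) ((StdForm.antidiagonal 3).over (w.1.adicCompletion L)))).comap
      eA.toMulEquiv.toMonoidHom)
  (hI : I = K0 ⊓ K1)
  (r₁ s₁ r₂ s₂ : ℕ)
  (Jg : Subgroup ↥(unitaryGroupOfForm (galAdicCompletionMap (L := L) (IsCMField.complexConj L) hw) ((StdForm.antidiagonal 3).over (w.1.adicCompletion L))))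
  (hJg : ∀ k : ↥(unitaryGroupOfForm (galAdicCompletionMap (L := L) (IsCMField.complexConj L) hw) ((StdForm.antidiagonal 3).over (w.1.adicCompletion L))),
    k ∈ Jg ↔ ∀ i j, Valued.v (((k : GL (Fin 3) (w.1.adicCompletion L)) : Matrix (Fin 3) (Fin 3) (w.1.adicCompletion L)) i j) ≤
      Valued.v ϖ ^ (![![0, r₁, s₁], ![r₂, 0, r₁], ![s₂, r₂, 0]] : Fin 3 → Fin 3 → ℕ) i j)
  (Je : Subgroup (Gqs L v)) (hJe : Je = Jg.comap eA.toMulEquiv.toMonoidHom)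

/-! ## §1 `J_e ≤ I` along `eA` -/

include hϖ hg₁ hK0 hK1 hI hJg hJe in
/-- **`J_e ≤ I`** when the N̄-side exponents are positive (`1 ≤ r₂`, `1 ≤ s₂`): the comap along `eA` of the model inclusion ★ p862547 `le_inf_conj_of_forall_mem_iff`
(`Jg ≤ K₀,w ⊓ g₁K₀,wg₁⁻¹`). [cite: BruhatTits1972, (4.4.4), (6.4.9)] [cite: Roche1998, §3] -/
theorem levelGroup_le_iwahori (h10 : 1 ≤ r₂) (h20 : 1 ≤ s₂) : Je ≤ I := by
  have hvσ : ∀ x, Valued.v (galAdicCompletionMap (L := L) (IsCMField.complexConj L) hw x) = Valued.v x :=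
    fun x => valued_galAdicCompletionMap (L := L) (IsCMField.complexConj L) hw x
  rw [hJe, hI, hK0, hK1, ← Subgroup.comap_inf]
  exact Subgroup.comap_mono (K2E3IwahoriTwoDepthLettersCM.le_inf_conj_of_forall_mem_iff (galAdicCompletionMap (L := L) (IsCMField.complexConj L) hw)
    (rfl : (StdForm.antidiagonal 3).over (w.1.adicCompletion L) = _) hvσ hϖ g₁ hg₁ _ Jg hJg h10 h20 h10)

/-! ## §2 Branch A at positive depth over `J_e`: reducibility is impossible -/

open Classical in
include hw heA hϖ hg₁ hK0 hK1 hI hJg hJe in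
set_option maxHeartbeats 1600000 in
set_option synthInstance.maxHeartbeats 400000 in
-- class of ★ p863059 §3: the Gqs-typed ★ letters meet the subtype-typed engine goals (instance unfolding); V1's witness is re-typed on arrival (p02's cure)
/-- **BRANCH A OF KEYS' THEOREM §7 (2) AT POSITIVE DEPTH OVER ROCHE'S TWO-DEPTH GROUP (design D-I, assembled in the (G3) frame).**  `v` non-split (`hns`); `χ₁` continuous,
non-unitary, contracting; exponents `(r₁, s₁; r₂, s₂)` with `r₁ + r₂ = m + 1`, `s₁ + s₂ = k + 1`, `k ≤ m`, `1 ≤ m`, `|r₁ − r₂| ≤ 1`, `|s₁ − s₂| ≤ 1`, aligned `r₁ ≤ r₂ ∧ s₁ ≤ s₂`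
(★ (B1b) p862832's output); conductor letters `hcond` (cond_E `≤ m + 1`) and `hcondF` (cond_F `≤ k + 1` on the `(c ⊗ 1)`-fixed units) with EXACT witnesses `u₁` (`≡ 1 mod 𝔭ᵐ`,
`χ₁ u₁ ≠ 1`) and `u₂` (`σ`-fixed, `≡ 1 mod 𝔭ᵏ`, `χ₁ u₂ ≠ 1`); an integral trace-one `t` (`t + σt = 1`, `|t| ≤ 1`); a unit `u` with `|u_{w′}| = 1` and `χ₁(u·σu) ≠ 1` (Branch A:
`χ₁ ∘ N ≠ 1` on `𝒪ˣ`); `w₀` of matrix `Φ₃`; `μ` a Haar measure on `N(L⁺_v)`.  Then `i(χ₁, 1)` is NOT reducible: ★ V1 (re-typed) → ★ p862547 datum (`K 0 = J_e`) → ★ p863059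
`false_of_iwahoriDatum_of_cells` with `hθmul` ★ p862709 `theta_mul_concave`, `hθH` ★ `theta_eq_tau_of_mem` via §1, `hθC` ★ `theta_eq_one_of_map_mem`, `B := J_e`,
`R := {w₀} ∪ {r ∈ N̄ : r ∉ J_e, eA r off the sharp big cell}`, `hwit` from ★ p862782 and ★ p862990 §2, `hcells` the trichotomy over ★ p862990 §1, `hθ` ★ `theta_conj_eq_one`, `hΛ` V1.
[cite: Keys1984, §3, §7 Thm (2)] [cite: Roche1998, §3–§4] [cite: Casselman1995, §6.3–§6.4] [cite: MoyPrasad1996, §3] [cite: BruhatTits1972, (6.4.9)] -/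
theorem false_of_reducible_of_twoDepth
    (hns : ∀ w' : PlacesOver L v, IsCMField.complexConj L • w'.1 = w'.1)
    (χ₁ : (LocalRing L v)ˣ →* ℂˣ) (h₁ : Continuous fun x => ((χ₁ x : ℂˣ) : ℂ)) (hnu : ∃ x, ‖((χ₁ x : ℂˣ) : ℂ)‖ ≠ 1)
    (hcontr : ∀ x : (LocalRing L v)ˣ, unitModulusChar (LocalRing L v) x < 1 → ‖((χ₁ x : ℂˣ) : ℂ)‖ < 1)
    {m k : ℕ} (hm : 1 ≤ m) (hkm : k ≤ m) (hrr : r₁ + r₂ = m + 1) (hss : s₁ + s₂ = k + 1)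
    (hr1 : r₁ ≤ r₂ + 1) (hr2 : r₂ ≤ r₁ + 1) (hs1 : s₁ ≤ s₂ + 1) (hs2 : s₂ ≤ s₁ + 1) (hal : r₁ ≤ r₂ ∧ s₁ ≤ s₂)
    (hcond : ∀ u : (LocalRing L v)ˣ, (∀ w' : PlacesOver L v, Valued.v (((u : LocalRing L v) w') - 1) ≤ Valued.v ϖ ^ (m + 1)) → χ₁ u = 1)
    (hcondF : ∀ u : (LocalRing L v)ˣ, Units.map (conjLocal L (IsCMField.complexConj L) v : LocalRing L v →* LocalRing L v) u = u →
      (∀ w' : PlacesOver L v, Valued.v (((u : LocalRing L v) w') - 1) ≤ Valued.v ϖ ^ (k + 1)) → χ₁ u = 1)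
    (u₁ : (LocalRing L v)ˣ) (hu₁ : ∀ w' : PlacesOver L v, Valued.v (((u₁ : LocalRing L v) w') - 1) ≤ Valued.v ϖ ^ m) (hχu₁ : χ₁ u₁ ≠ 1)
    (u₂ : (LocalRing L v)ˣ) (hσu₂ : Units.map (conjLocal L (IsCMField.complexConj L) v : LocalRing L v →* LocalRing L v) u₂ = u₂)
    (hu₂ : ∀ w' : PlacesOver L v, Valued.v (((u₂ : LocalRing L v) w') - 1) ≤ Valued.v ϖ ^ k) (hχu₂ : χ₁ u₂ ≠ 1)
    {t : w.1.adicCompletion L} (ht : t + galAdicCompletionMap (L := L) (IsCMField.complexConj L) hw t = 1) (hvt : Valued.v t ≤ 1)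
    (u : (LocalRing L v)ˣ) (hu : ∀ w' : PlacesOver L v, Valued.v ((u : LocalRing L v) w') = 1)
    (hA : χ₁ (u * Units.map (conjLocal L (IsCMField.complexConj L) v : LocalRing L v →* LocalRing L v) u) ≠ 1)
    (w₀ : ↥(unitaryGroupOfForm (conjLocal L (IsCMField.complexConj L) v) (cmLocalForm L 3 v))) (hw₀ : Units.val (w₀ : GL (Fin 3) (LocalRing L v)) = cmLocalForm L 3 v)
    [MeasurableSpace ↥(cmBorelTriple L 3 v).N] [BorelSpace ↥(cmBorelTriple L 3 v).N] (μ : Measure ↥(cmBorelTriple L 3 v).N) [μ.IsHaarMeasure]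
    (hred : ∃ N : Subrepresentation (cmPrincipalSeries L 3 v (cmTorusCharPair L v χ₁ 1)), N ≠ ⊥ ∧ N ≠ ⊤) : False := by
  haveI := locallyCompactSpace_cmBorelU L 3 v
  -- the N̄-side exponents are positive; the exponent matrix has zero diagonal and is anti-transpose symmetric
  have h10 : 1 ≤ r₂ := by omega
  have h20 : 1 ≤ s₂ := by omega
  have he0 : ∀ i : Fin 3, (![![0, r₁, s₁], ![r₂, 0, r₁], ![s₂, r₂, 0]] : Fin 3 → Fin 3 → ℕ) i i = 0 := fun i => by
    fin_cases i <;> rfl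
  have hJI : Je ≤ I := levelGroup_le_iwahori L v w hw eA hϖ g₁ hg₁ K0 K1 I hK0 hK1 hI r₁ s₁ r₂ s₂ Jg hJg Je hJe h10 h20
  -- `w₀² = 1` (★ `w₀_mul_w₀_mem` at the trivial subgroup)
  have hww : w₀ * w₀ = 1 := Subgroup.mem_bot.1 (w₀_mul_w₀_mem L v w hw eA heA ⊥ w₀ hw₀)
  have hwinv : w₀⁻¹ = w₀ := inv_eq_of_mul_eq_one_right hww
  -- ★ V1: a `G`-stable `V ∋ f`, `f(1) ≠ 0`, killed by the intertwining functional `Λ_{w₀}` (witness RE-TYPED on arrival in the `smoothIndRep` currency — p02's cure)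
  have h₂ : Continuous fun x : ↥(normOneUnits (conjLocal L (IsCMField.complexConj L) v)) =>
      (((1 : ↥(normOneUnits (conjLocal L (IsCMField.complexConj L) v)) →* ℂˣ) x : ℂˣ) : ℂ) := by
    simp only [MonoidHom.one_apply]; exact continuous_const
  obtain ⟨V, f, hfV, hf1, hΛ⟩ : ∃ (V : Subrepresentation (Representation.smoothIndRep (cmBorelTriple L 3 v).P
      (Representation.twist
      (((Representation.trivial ℂ ↥(torusU (conjLocal L (IsCMField.complexConj L) v) (cmLocalForm L 3 v)) ℂ).twist
        (cmTorusCharPair L v χ₁ 1)).comp (cmBorelTriple L 3 v).proj) (rootDeltaChar (cmBorelTriple L 3 v).P))))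
      (f : Representation.SmoothInd (cmBorelTriple L 3 v).P
      (Representation.twist
      (((Representation.trivial ℂ ↥(torusU (conjLocal L (IsCMField.complexConj L) v) (cmLocalForm L 3 v)) ℂ).twist
        (cmTorusCharPair L v χ₁ 1)).comp (cmBorelTriple L 3 v).proj) (rootDeltaChar (cmBorelTriple L 3 v).P))),
      f ∈ V ∧ f.toFun 1 ≠ 0 ∧ ∀ f', f' ∈ V → ∀ g : ↥(unitaryGroupOfForm (conjLocal L (IsCMField.complexConj L) v) (cmLocalForm L 3 v)),
        ∫ n : ↥(cmBorelTriple L 3 v).N, f'.toFun (w₀ * (n : ↥(unitaryGroupOfForm (conjLocal L (IsCMField.complexConj L) v) (cmLocalForm L 3 v))) * g) ∂μ = 0 :=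
    K2E3IntertwiningKernelOfReducible.exists_section_apply_one_ne_zero_forall_intertwiningIntegral_eq_zero L v hns χ₁ 1 h₁ h₂ hnu hcontr hred w₀ hw₀ μ
  -- ★ p862782 (c2)^{<}: the torus witness at `w₀` in `J_e`; ★ p862990 §2: the shell witnesses
  obtain ⟨b₀, hb₀P, hb₀J, -, hne⟩ := K2E3BranchATorusWitnessLevelGroup.exists_torusWitness_levelGroup L v w hw eA heA hϖ g₁ hg₁ K0 K1 I hK0 hK1 hI
    _ Jg hJg Je hJe w₀ hw₀ he0 χ₁ u hu hA
  have hwitS : ∀ r : Gqs L v, r ∈ ((cmBorelTriple L 3 v).N).map (MulAut.conj w₀).toMonoidHom → r ∉ Je →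
      ¬ (Valued.v ((((eA r : ↥(unitaryGroupOfForm (galAdicCompletionMap (L := L) (IsCMField.complexConj L) hw) ((StdForm.antidiagonal 3).over (w.1.adicCompletion L)))) :
            GL (Fin 3) (w.1.adicCompletion L)) : Matrix (Fin 3) (Fin 3) (w.1.adicCompletion L)) 2 1 /
          (((eA r : ↥(unitaryGroupOfForm (galAdicCompletionMap (L := L) (IsCMField.complexConj L) hw) ((StdForm.antidiagonal 3).over (w.1.adicCompletion L)))) :
            GL (Fin 3) (w.1.adicCompletion L)) : Matrix (Fin 3) (Fin 3) (w.1.adicCompletion L)) 2 0) ≤ Valued.v ϖ ^ r₁ ∧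
        (Valued.v ϖ ^ s₁)⁻¹ ≤ Valued.v ((((eA r :
          ↥(unitaryGroupOfForm (galAdicCompletionMap (L := L) (IsCMField.complexConj L) hw) ((StdForm.antidiagonal 3).over (w.1.adicCompletion L)))) :
            GL (Fin 3) (w.1.adicCompletion L)) : Matrix (Fin 3) (Fin 3) (w.1.adicCompletion L)) 2 0)) →
      ∃ (b : Gqs L v) (hbP : ((r * b * r⁻¹ : Gqs L v) : ↥(unitaryGroupOfForm (conjLocal L (IsCMField.complexConj L) v) (cmLocalForm L 3 v))) ∈ (cmBorelTriple L 3 v).P),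
        b ∈ Je ∧
        (if h : IsUnit (((b.val : GL (Fin 3) (LocalRing L v)) : Matrix (Fin 3) (Fin 3) (LocalRing L v)) 0 0) then ((χ₁ h.unit : ℂˣ) : ℂ) else 0) ≠
          (Representation.twist
              (((Representation.trivial ℂ ↥(torusU (conjLocal L (IsCMField.complexConj L) v) (cmLocalForm L 3 v)) ℂ).twist
                (cmTorusCharPair L v χ₁ 1)).comp (cmBorelTriple L 3 v).proj) (rootDeltaChar (cmBorelTriple L 3 v).P))
            ⟨((r * b * r⁻¹ : Gqs L v) : ↥(unitaryGroupOfForm (conjLocal L (IsCMField.complexConj L) v) (cmLocalForm L 3 v))), hbP⟩ 1 :=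
    fun r hr hoff hs => K2E3BranchAIrreducibleTwoDepthCells.exists_shellWitness_of_mem_map_of_not_mem L v w hw eA heA hϖ r₁ s₁ r₂ s₂ Jg hJg Je hJe w₀ hw₀
      hm hkm hrr hss hr1 hr2 hs1 hs2 (Or.inl hal) h10 h20 ht hvt χ₁ hcond u₁ hu₁ hχu₁ u₂ hσu₂ hu₂ hχu₂ hr hoff hs
  -- ★ p862547: the Iwahori datum with `K 0 = J_e`, `K 1 = I`, `N̄ = eA⁻¹(N̄_w)`
  obtain ⟨𝓘, hK0J, -, hNbar⟩ := K2E3IwahoriTwoDepthLettersCM.exists_iwahoriDatum_K_zero_eq_levelGroup L v w hw eA heA hϖ g₁ hg₁ K0 K1 I hK0 hK1 hI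
    _ Jg hJg Je hJe he0 (K2E3IwahoriTwoDepthFactorisation.twoDepth_symm r₁ s₁ r₂ s₂) h10 h20
  subst hK0J
  -- ★ p863059 §2 with `B := J_e`, `θ(g) = χ₁(unit g₀₀)`, `R := {w₀} ∪ {shell representatives}`
  refine K2E3BranchAIrreduciblePosDepth.false_of_iwahoriDatum_of_cells (cmBorelTriple L 3 v)
    (Representation.twist
      (((Representation.trivial ℂ ↥(torusU (conjLocal L (IsCMField.complexConj L) v) (cmLocalForm L 3 v)) ℂ).twist
        (cmTorusCharPair L v χ₁ 1)).comp (cmBorelTriple L 3 v).proj) (rootDeltaChar (cmBorelTriple L 3 v).P)) 𝓘 μ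
    (LineRing.isClosed_unipotentU (conjLocal L (IsCMField.complexConj L) v) (cmLocalForm L 3 v))
    (fun g : ↥(unitaryGroupOfForm (conjLocal L (IsCMField.complexConj L) v) (cmLocalForm L 3 v)) =>
      if h : IsUnit (((g : GL (Fin 3) (LocalRing L v)) : Matrix (Fin 3) (Fin 3) (LocalRing L v)) 0 0) then ((χ₁ h.unit : ℂˣ) : ℂ) else 0)
    (fun x hx y hy => theta_mul_concave L v w hw eA heA hϖ _ Jg hJg (𝓘.K 0) hJe h10 h20 χ₁ (Nat.succ_le_succ (Nat.zero_le k)) (Nat.succ_le_succ hkm)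
      hcond hcondF ht hvt (show m + 1 ≤ r₁ + r₂ by omega) (show m + 1 ≤ 2 * r₁ + s₂ by omega) (show m + 1 ≤ s₁ + 2 * r₂ by omega)
      (show k + 1 ≤ s₁ + s₂ by omega) hx hy)
    (fun p hp hpJ => theta_eq_tau_of_mem L v w hw eA heA hϖ g₁ hg₁ K0 K1 I hK0 hK1 hI χ₁ p hp (hJI hpJ))
    (fun c hc => theta_eq_one_of_map_mem L v w hw eA heA χ₁ (by
      have h := (Subgroup.mem_inf.1 hc).2
      rw [hNbar] at h
      exact h))
    V f hfV hf1 w₀ (by rw [hww]; exact Subgroup.one_mem _)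
    ({w₀} ∪ {r : ↥(unitaryGroupOfForm (conjLocal L (IsCMField.complexConj L) v) (cmLocalForm L 3 v)) |
      r ∈ ((cmBorelTriple L 3 v).N).map (MulAut.conj w₀).toMonoidHom ∧ r ∉ 𝓘.K 0 ∧
      ¬ (Valued.v ((((eA r : ↥(unitaryGroupOfForm (galAdicCompletionMap (L := L) (IsCMField.complexConj L) hw) ((StdForm.antidiagonal 3).over (w.1.adicCompletion L)))) :
            GL (Fin 3) (w.1.adicCompletion L)) : Matrix (Fin 3) (Fin 3) (w.1.adicCompletion L)) 2 1 /
          (((eA r : ↥(unitaryGroupOfForm (galAdicCompletionMap (L := L) (IsCMField.complexConj L) hw) ((StdForm.antidiagonal 3).over (w.1.adicCompletion L)))) :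
            GL (Fin 3) (w.1.adicCompletion L)) : Matrix (Fin 3) (Fin 3) (w.1.adicCompletion L)) 2 0) ≤ Valued.v ϖ ^ r₁ ∧
        (Valued.v ϖ ^ s₁)⁻¹ ≤ Valued.v ((((eA r :
          ↥(unitaryGroupOfForm (galAdicCompletionMap (L := L) (IsCMField.complexConj L) hw) ((StdForm.antidiagonal 3).over (w.1.adicCompletion L)))) :
            GL (Fin 3) (w.1.adicCompletion L)) : Matrix (Fin 3) (Fin 3) (w.1.adicCompletion L)) 2 0))})
    ?_ ?_ (fun n _ => theta_conj_eq_one L v w hw eA heA (cmBorelTriple L 3 v) rfl w₀ hw₀ χ₁ n.2) (fun f' hf'V => hΛ f' hf'V w₀)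
  · -- `hwit`: the torus witness at `w₀` (★ p862782), the shell witnesses (★ p862990 §2)
    rintro r (hr | ⟨hr, hoff, hs⟩)
    · rw [Set.mem_singleton_iff] at hr
      subst hr
      exact ⟨b₀, hb₀J, hb₀P, hne⟩
    · obtain ⟨b, hbP, hbJ, hne'⟩ := hwitS r hr hoff hs
      exact ⟨b, hbJ, hbP, hne'⟩
  · -- `hcells`: the trichotomy
    intro n
    by_cases hJ : w₀ * (n : ↥(unitaryGroupOfForm (conjLocal L (IsCMField.complexConj L) v) (cmLocalForm L 3 v))) * w₀ ∈ 𝓘.K 0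
    · exact Or.inl hJ
    right
    by_cases hs :
      Valued.v ((((eA (w₀ * (n : ↥(unitaryGroupOfForm (conjLocal L (IsCMField.complexConj L) v) (cmLocalForm L 3 v))) * w₀) :
          ↥(unitaryGroupOfForm (galAdicCompletionMap (L := L) (IsCMField.complexConj L) hw) ((StdForm.antidiagonal 3).over (w.1.adicCompletion L)))) :
            GL (Fin 3) (w.1.adicCompletion L)) : Matrix (Fin 3) (Fin 3) (w.1.adicCompletion L)) 2 1 /
          (((eA (w₀ * (n : ↥(unitaryGroupOfForm (conjLocal L (IsCMField.complexConj L) v) (cmLocalForm L 3 v))) * w₀) :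
          ↥(unitaryGroupOfForm (galAdicCompletionMap (L := L) (IsCMField.complexConj L) hw) ((StdForm.antidiagonal 3).over (w.1.adicCompletion L)))) :
            GL (Fin 3) (w.1.adicCompletion L)) : Matrix (Fin 3) (Fin 3) (w.1.adicCompletion L)) 2 0) ≤ Valued.v ϖ ^ r₁ ∧
        (Valued.v ϖ ^ s₁)⁻¹ ≤ Valued.v ((((eA (w₀ * (n : ↥(unitaryGroupOfForm (conjLocal L (IsCMField.complexConj L) v) (cmLocalForm L 3 v))) * w₀) :
          ↥(unitaryGroupOfForm (galAdicCompletionMap (L := L) (IsCMField.complexConj L) hw) ((StdForm.antidiagonal 3).over (w.1.adicCompletion L)))) :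
            GL (Fin 3) (w.1.adicCompletion L)) : Matrix (Fin 3) (Fin 3) (w.1.adicCompletion L)) 2 0)
    · -- ★ p862990 §1: the sharp big cell `w₀ n w₀ = h · w₀ · b′`
      obtain ⟨h, hh, b', hb', e⟩ := K2E3BranchAIrreducibleTwoDepthCells.exists_eq_borel_mul_weyl_mul_mem_of_sharp L v w hw eA heA hϖ r₁ s₁ r₂ s₂ Jg hJg (𝓘.K 0) hJe
        w₀ hw₀ (cmBorelTriple L 3 v) rfl n.2 hs
      exact ⟨w₀, Set.mem_union_left _ (Set.mem_singleton w₀), h, hh, b', hb', e⟩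
    · -- a shell representative: `r := w₀ n w₀` itself, `h = b′ = 1`
      have hmem : w₀ * (n : ↥(unitaryGroupOfForm (conjLocal L (IsCMField.complexConj L) v) (cmLocalForm L 3 v))) * w₀ ∈
          ((cmBorelTriple L 3 v).N).map (MulAut.conj w₀).toMonoidHom :=
        Subgroup.mem_map.2 ⟨n, n.2, by rw [MulEquiv.coe_toMonoidHom, MulAut.conj_apply, hwinv]⟩
      refine ⟨w₀ * (n : ↥(unitaryGroupOfForm (conjLocal L (IsCMField.complexConj L) v) (cmLocalForm L 3 v))) * w₀, Set.mem_union_right _ ?_, 1, Subgroup.one_mem _, 1, Subgroup.one_mem _,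
        by rw [one_mul, mul_one]⟩
      rw [Set.mem_setOf_eq]
      exact ⟨hmem, hJ, hs⟩

end Summit.HodgeConjecture.HodgeConjecture.Cruxes.H413.K2E3BranchAIrreducibleTwoDepth

end
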